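import Literature.Geometry.Lorentzian.HarmonicallyFlatGradientProofs
import Literature.Geometry.Lorentzian.CoordLaplacianPerturbation
import Literature.Geometry.Lorentzian.ChartMetricCoord
import Literature.Geometry.Lorentzian.DalembertianNaturality
import Literature.Geometry.Lorentzian.AsymptoticallyFlatChart
import Literature.Geometry.Lorentzian.AsymptoticFlatnessChart
import Literature.Geometry.Lorentzian.MassCapacity
import Literature.Geometry.Lorentzian.DecaySymbols
import HarnessLib

/-!
# Harmonic functions on a harmonically flat end: conformal reduction to the flat Laplacian and
# Bray's expansion (87), `φ = L − c/r + O₁(r⁻²)`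

Companion of `HarmonicallyFlat.lean` / `HarmonicallyFlatGradientProofs.lean` and of the
capacity files `MassCapacity*.lean`, on the discharge path of the named fact
`Bray2001_mass_ge_half_capacity` (Bray, J. Differential Geom. 59 (2001), Thm. 9). Bray, §6,
(86)–(87): the Green's function `φ` of a horizon (`Δφ = 0` outside `Σ`, `φ = 0` on `Σ`, `φ → 1`)
satisfies *"`φ(x) = 1 − ℰ/(2|x|) + O(1/|x|²)`"* — like the conformal factor in §2, (10), "by
expanding in spherical harmonics", which presupposes that the end is **harmonically flat**
(§2 Def. 1: `g = 𝒰(x)⁴ δ` beyond a compact set with `𝒰` harmonic, as arranged by Lemma 1 and the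
Assumption of §3). On such an end `Δ_g φ = 𝒰⁻⁵ (Δ_δ(𝒰φ) − φ Δ_δ 𝒰) = 𝒰⁻⁵ Δ_δ(𝒰φ)`, so `𝒰φ`
is a flat-harmonic function tending to a constant, to which the expansion with gradient control
of `HarmonicallyFlatGradientProofs.lean` (Green's representation formula) applies; dividing by
the expansion of `𝒰` gives (87) together with the gradient estimate
`D(φ ∘ Φ − (L − c/r)) = O(r⁻³)`, which is the form (`hexp`) in which the capacity theorems of
`MassCapacityExpansion.lean` consume it (`ℰ(Σ, g) = 2c`).

* `MetricCoord.lapAt_congr_metric` — the coordinate Laplace–Beltrami operator `lapAt G f x` only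
  depends on the germ of the components `G` at `x`;
  `MetricCoord.fderiv_fderiv_mul_apply_apply`, `MetricCoord.sum_fderiv_fderiv_mul` — Leibniz
  rule for second derivatives at a point; `MetricCoord.laplacian_apply_eq_sum` — Mathlib's
  Laplacian is `∑ᵢ D²f(bᵢ, bᵢ)`;
* `MetricCoord.laplacian_mul_eq_of_conformal` — **conformal covariance of the Laplacian in
  dimension three**: `Δ_δ(wF) = w⁵ Δ_{w⁴δ} F + F Δ_δ w` (from `lapAt_conformal_inner_eq_sum`,
  `CoordLaplacianPerturbation.lean`: `Δ_{w⁴δ}F = w⁻⁴(Δ_δ F + 2w⁻¹⟨∇w, ∇F⟩)`; Besse 1987,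
  Thm. 1.159);
* `AFEnd.dalembertian_dataChart_eq_lapAt_endValue` — `Δ_h φ (Φ z) = Δ_{hCoeff} (φ ∘ Φ)(z)`: the
  Laplace–Beltrami operator of the data read in the chart of the end (naturality
  `dalembertian_comap` and `OpensChart.dalembertian_eq_lapAt`);
  `AFEnd.contDiffAt_endValue_of_contMDiffAt` (local smoothness of `φ ∘ Φ`);
* `AFEnd.IsHarmonicallyFlatWith.contDiffAt_factor` — the conformal factor `𝒰` is smooth beyond
  `R₁` (`𝒰⁴ = h₁₁`, `𝒰 > 0`); `….harmonicAt_factor_mul_endValue` — **`𝒰 · (φ ∘ Φ)` is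
  flat-harmonic** wherever `φ` is `h`-harmonic;
* `isBigO_div_sub_expansion` — division of expansions `a + b/r + O(r⁻²)` with gradient control
  `O(r⁻³)` (with `isBigO_inv_sub_inv`, `isBigO_div_sq_sub`, `isBigO_fderiv_add_dipole`,
  `isBigO_dipoleKernel`: the dipole kernel `K(x) = ‖x‖⁻³⟨x, ·⟩ = −D(1/r)` has norm `‖x‖⁻²`);
* `AFEnd.IsHarmonicallyFlatWith.exists_expansion_fderiv_of_dalembertian_eq_zero` — **main
  theorem, Bray's (87) on a harmonically flat end**: if `φ` is `C²` and `h`-harmonic on a far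
  region and `φ → L` at infinity in the end, then for some `c`,
  `φ ∘ Φ − (L − c/r) = O(r⁻²)` and `‖D(φ ∘ Φ − (L − c/r))‖ = O(r⁻³)` along `cobounded E3`.

Everything is proved; there are no definitions and no named facts.

## References

* H. L. Bray, *Proof of the Riemannian Penrose inequality using the positive mass theorem*,
  J. Differential Geom. 59 (2001) 177–267 (arXiv:math/9911173): §2 Def. 1, (9)–(10); §6
  (86)–(87) (key `BrayRPI2001`).
* A. L. Besse, *Einstein Manifolds*, Springer 1987, Thm. 1.159 (conformal change of the
  Laplacian) (key `Besse1987`).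
* B. O'Neill, *Semi-Riemannian geometry*, Academic Press 1983, Ch. 3, Def. 3.50 ff., Prop. 3.59
  (key `ONeill1983`).
* G. B. Folland, *Introduction to Partial Differential Equations*, 2nd ed., Prop. 2.75, (2.76)
  (the spherical-harmonics route to (10)/(87), not followed here).
-/

noncomputable section

open Set Function Filter Metric Bornology Asymptotics Topology InnerProductSpace Manifold Bundle
open scoped Real ContDiff RealInnerProductSpace Manifold Laplacian

namespace Literature.Geometry.Lorentzian

/-! ## Coordinate lemmas -/

namespace MetricCoord

section Congr

variable {E : Type*} [NormedAddCommGroup E] [NormedSpace ℝ E] [FiniteDimensional ℝ E]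
  {G G' : E → E →L[ℝ] E →L[ℝ] ℝ} {x : E}

/-- The coordinate Laplace–Beltrami operator only depends on the germ of the components at the
point (it involves `G x` and `DG(x)`). [folklore] -/
theorem lapAt_congr_metric (h : G =ᶠ[𝓝 x] G') (f : E → ℝ) : lapAt G f x = lapAt G' f x := by
  have h0 : G x = G' x := h.eq_of_nhds
  have h1 : fderiv ℝ G x = fderiv ℝ G' x := h.fderiv_eq
  have hs : sharpAt G x = sharpAt G' x := by
    simp only [sharpAt, h0]
  have hk : koszulCLM G x = koszulCLM G' x := by
    simp only [koszulCLM, h1]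
  have hc : chrAt G x = chrAt G' x := by
    simp only [chrAt, hs, hk]
  simp only [lapAt, mtrAt, hessAt, hs, hc]

end Congr

section Leibniz

variable {E : Type*} [NormedAddCommGroup E] [NormedSpace ℝ E]

/-- **Leibniz rule for second derivatives**: for `w, F` of class `C²` at `x`,
`D²(wF)(x)(v, u) = F D²w(v,u) + w D²F(v,u) + Dw(u) DF(v) + Dw(v) DF(u)`. [folklore] -/
theorem fderiv_fderiv_mul_apply_apply {w F : E → ℝ} {x : E} (hw : ContDiffAt ℝ 2 w x)
    (hF : ContDiffAt ℝ 2 F x) (v u : E) :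
    fderiv ℝ (fderiv ℝ (fun y ↦ w y * F y)) x v u =
      F x * fderiv ℝ (fderiv ℝ w) x v u + w x * fderiv ℝ (fderiv ℝ F) x v u
        + fderiv ℝ w x u * fderiv ℝ F x v + fderiv ℝ w x v * fderiv ℝ F x u := by
  have hw1 : ∀ᶠ y in 𝓝 x, DifferentiableAt ℝ w y :=
    (hw.eventually (by simp)).mono fun y hy ↦ hy.differentiableAt (by simp)
  have hF1 : ∀ᶠ y in 𝓝 x, DifferentiableAt ℝ F y :=
    (hF.eventually (by simp)).mono fun y hy ↦ hy.differentiableAt (by simp)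
  have heq : fderiv ℝ (fun y ↦ w y * F y) =ᶠ[𝓝 x]
      fun y ↦ F y • fderiv ℝ w y + w y • fderiv ℝ F y := by
    filter_upwards [hw1, hF1] with y hy hy'
    rw [fderiv_fun_mul hy hy', add_comm]
  rw [heq.fderiv_eq]
  have hdw : DifferentiableAt ℝ (fderiv ℝ w) x :=
    (hw.fderiv_right (m := 1) (by norm_num)).differentiableAt one_ne_zero
  have hdF : DifferentiableAt ℝ (fderiv ℝ F) x :=
    (hF.fderiv_right (m := 1) (by norm_num)).differentiableAt one_ne_zero
  have hwx : DifferentiableAt ℝ w x := hw.differentiableAt (by simp)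
  have hFx : DifferentiableAt ℝ F x := hF.differentiableAt (by simp)
  have hA : DifferentiableAt ℝ (fun y ↦ F y • fderiv ℝ w y) x := hFx.smul hdw
  have hB : DifferentiableAt ℝ (fun y ↦ w y • fderiv ℝ F y) x := hwx.smul hdF
  rw [fderiv_fun_add hA hB, fderiv_fun_smul hFx hdw, fderiv_fun_smul hwx hdF]
  simp only [_root_.add_apply, FunLike.coe_smul, Pi.smul_apply,
    ContinuousLinearMap.smulRight_apply, smul_eq_mul]
  ring

/-- **Leibniz rule for the trace of the Hessian**: `∑ᵢ D²(wF)(bᵢ,bᵢ) =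
F ∑ᵢ D²w(bᵢ,bᵢ) + w ∑ᵢ D²F(bᵢ,bᵢ) + 2 ∑ᵢ Dw(bᵢ) DF(bᵢ)`. [folklore] -/
theorem sum_fderiv_fderiv_mul {ι : Type*} [Fintype ι] (b : ι → E) {w F : E → ℝ} {x : E}
    (hw : ContDiffAt ℝ 2 w x) (hF : ContDiffAt ℝ 2 F x) :
    ∑ i, fderiv ℝ (fderiv ℝ (fun y ↦ w y * F y)) x (b i) (b i) =
      F x * ∑ i, fderiv ℝ (fderiv ℝ w) x (b i) (b i)
        + w x * ∑ i, fderiv ℝ (fderiv ℝ F) x (b i) (b i)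
        + 2 * ∑ i, fderiv ℝ w x (b i) * fderiv ℝ F x (b i) := by
  simp only [fderiv_fderiv_mul_apply_apply hw hF, Finset.sum_add_distrib, Finset.mul_sum]
  simp only [← Finset.sum_add_distrib]
  exact Finset.sum_congr rfl fun i _ ↦ by ring

end Leibniz

section Flat

variable {E : Type*} [NormedAddCommGroup E] [InnerProductSpace ℝ E] [FiniteDimensional ℝ E]

/-- **Mathlib's Laplacian is the trace of the second derivative**:
`Δ f (x) = ∑ᵢ D²f(x)(bᵢ, bᵢ)` in an orthonormal basis (`laplacian_eq_iteratedFDeriv_orthonormalBasis`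
with `iteratedFDeriv_two_apply`). [folklore] -/
theorem laplacian_apply_eq_sum {ι : Type*} [Fintype ι] (b : OrthonormalBasis ι ℝ E) (f : E → ℝ)
    (x : E) : (Δ f) x = ∑ i, fderiv ℝ (fderiv ℝ f) x (b i) (b i) := by
  rw [laplacian_eq_iteratedFDeriv_orthonormalBasis f b]
  exact Finset.sum_congr rfl fun i _ ↦ by rw [iteratedFDeriv_two_apply]; rfl

/-- **Conformal covariance of the Laplacian in dimension three** (Bray 2001, §2, the sentence
after (9): "`𝒰₀` is harmonic in `(ℝ³ ∖ B, δ)`"; Besse 1987, Thm. 1.159): on an open `V ⊆ E`,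
`dim E = 3`, with `w` smooth and nowhere zero on `V` and `F` of class `C²` at `y ∈ V`,
`w(y)⁵ Δ_{w⁴δ} F (y) + F(y) Δ_δ w (y) = Δ_δ (wF)(y)`, where `Δ_{w⁴δ} = lapAt (w⁴ δ)` is the
coordinate Laplace–Beltrami operator and `Δ_δ` is Mathlib's Laplacian (`Δ_{w⁴δ} F =
w⁻⁴(ΔF + 2w⁻¹⟨∇w,∇F⟩)`, `lapAt_conformal_inner_eq_sum`, and Leibniz). In particular, for `w`
harmonic, `F` is `w⁴δ`-harmonic iff `wF` is `δ`-harmonic. [cite: BrayRPI2001, §2 (9)–(10)]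
[cite: Besse1987, Thm. 1.159] -/
theorem laplacian_mul_eq_of_conformal {ι : Type*} [Fintype ι] (b : OrthonormalBasis ι ℝ E)
    (h3 : Fintype.card ι = 3) {V : Set E} (hV : IsOpen V) {w : E → ℝ} (hw : ContDiffOn ℝ ∞ w V)
    (hw0 : ∀ z ∈ V, w z ≠ 0) {y : E} (hy : y ∈ V) {F : E → ℝ} (hF : ContDiffAt ℝ 2 F y) :
    (Δ fun z ↦ w z * F z) y =
      w y ^ 5 * lapAt (fun z ↦ w z ^ 4 • (innerSL ℝ (E := E) : E →L[ℝ] E →L[ℝ] ℝ)) F y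
        + F y * (Δ w) y := by
  have hwy : ContDiffAt ℝ 2 w y :=
    ((hw y hy).contDiffAt (hV.mem_nhds hy)).of_le (WithTop.coe_le_coe.mpr le_top)
  rw [laplacian_apply_eq_sum b, laplacian_apply_eq_sum b, sum_fderiv_fderiv_mul b hwy hF,
    lapAt_conformal_inner_eq_sum (δ := (innerSL ℝ (E := E) : E →L[ℝ] E →L[ℝ] ℝ))
      (fun _ _ ↦ rfl) b hV hw hw0 hy F, h3]
  have hw0y : w y ≠ 0 := hw0 y hy
  push_cast
  field_simp
  ring

end Flat

end MetricCoord

/-! ## Division of expansions at infinity -/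

section Division

/-- `‖x‖⁻¹ = ‖x‖^{-1}`. [folklore] -/
theorem inv_norm_eq_rpow (x : E3) : ‖x‖⁻¹ = ‖x‖ ^ (-1 : ℝ) := (Real.rpow_neg_one ‖x‖).symm

/-- A function with an expansion `a + b/r + O(r⁻²)` is `a + O(r⁻¹)`. [folklore] -/
theorem HasHarmonicExpansion.isBigO_sub_const {U : E3 → ℝ} {a b : ℝ}
    (h : HasHarmonicExpansion U a b) :
    (fun x ↦ U x - a) =O[cobounded E3] fun x ↦ ‖x‖ ^ (-1 : ℝ) := by
  have h1 : (fun x ↦ U x - a) = fun x ↦ (U x - (a + b * ‖x‖⁻¹)) + b * ‖x‖ ^ (-1 : ℝ) := by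
    funext x
    rw [inv_norm_eq_rpow]
    ring
  rw [h1]
  exact (h.trans (AFEnd.isBigO_norm_rpow_cobounded (by norm_num))).add
    ((isBigO_refl (fun x : E3 ↦ ‖x‖ ^ (-1 : ℝ)) _).const_mul_left b)

/-- If `f → a ≠ 0` and `f - a = O(g)` then `f⁻¹ - a⁻¹ = O(g)` (`f⁻¹` is eventually bounded).
[folklore] -/
theorem isBigO_inv_sub_inv {f : E3 → ℝ} {a : ℝ} {g : E3 → ℝ} (ha : a ≠ 0)
    (hf : Tendsto f (cobounded E3) (𝓝 a)) (hfa : (fun x ↦ f x - a) =O[cobounded E3] g) :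
    (fun x ↦ (f x)⁻¹ - a⁻¹) =O[cobounded E3] g := by
  have hinv : (fun x ↦ (f x)⁻¹) =O[cobounded E3] (fun _ ↦ (1 : ℝ)) := (hf.inv₀ ha).isBigO_one ℝ
  have hne : ∀ᶠ x in cobounded E3, f x ≠ 0 := hf.eventually_ne ha
  have heq : (fun x ↦ (f x)⁻¹ - a⁻¹) =ᶠ[cobounded E3] fun x ↦ (f x - a) * (-((f x)⁻¹ * a⁻¹)) := by
    filter_upwards [hne] with x hx
    field_simp
    ring
  refine (IsBigO.mul hfa ((hinv.mul (isBigO_const_const a⁻¹ one_ne_zero _)).neg_left)).congr' heq.symm ?_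
  exact Eventually.of_forall fun x ↦ by simp

/-- If `f → a ≠ 0`, `f - a = O(g)`, `h - b = O(g)` with `g` and `f` eventually bounded, then
`h/f² - b/a² = O(g)`. [folklore] -/
theorem isBigO_div_sq_sub {f h : E3 → ℝ} {a b : ℝ} {g : E3 → ℝ} (ha : a ≠ 0)
    (hf : Tendsto f (cobounded E3) (𝓝 a)) (hfa : (fun x ↦ f x - a) =O[cobounded E3] g)
    (hhb : (fun x ↦ h x - b) =O[cobounded E3] g) :
    (fun x ↦ h x / f x ^ 2 - b / a ^ 2) =O[cobounded E3] g := by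
  have hinv : (fun x ↦ (f x)⁻¹) =O[cobounded E3] (fun _ ↦ (1 : ℝ)) := (hf.inv₀ ha).isBigO_one ℝ
  have hfb : f =O[cobounded E3] (fun _ ↦ (1 : ℝ)) := hf.isBigO_one ℝ
  have hne : ∀ᶠ x in cobounded E3, f x ≠ 0 := hf.eventually_ne ha
  have heq : (fun x ↦ h x / f x ^ 2 - b / a ^ 2) =ᶠ[cobounded E3] fun x ↦
      ((h x - b) * a ^ 2 - (f x - a) * (b * (f x + a))) * ((f x)⁻¹ * (f x)⁻¹ * (a ^ 2)⁻¹) := by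
    filter_upwards [hne] with x hx
    field_simp
    ring
  have h1 : (fun x ↦ (h x - b) * a ^ 2 - (f x - a) * (b * (f x + a))) =O[cobounded E3] g := by
    have hA : (fun x ↦ (h x - b) * a ^ 2) =O[cobounded E3] g :=
      (hhb.mul (isBigO_const_const (a ^ 2) one_ne_zero _)).congr_right fun _ ↦ by simp
    have hB : (fun x ↦ (f x - a) * (b * (f x + a))) =O[cobounded E3] g := by
      have hb1 : (fun x ↦ b * (f x + a)) =O[cobounded E3] (fun _ ↦ (1 : ℝ)) :=
        ((hfb.add (isBigO_const_const a one_ne_zero _)).const_mul_left b)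
      exact (hfa.mul hb1).congr_right fun _ ↦ by simp
    exact hA.sub hB
  have h2 : (fun x ↦ (f x)⁻¹ * (f x)⁻¹ * (a ^ 2)⁻¹) =O[cobounded E3] (fun _ ↦ (1 : ℝ)) := by
    have := (hinv.mul hinv).mul (isBigO_const_const (a ^ 2)⁻¹ one_ne_zero (cobounded E3))
    exact this.congr_right fun _ ↦ by simp
  exact ((h1.mul h2).congr_right fun _ ↦ by simp).congr' heq.symm EventuallyEq.rfl

/-- The dipole kernel `K(x) = ‖x‖⁻³ ⟨x, ·⟩` (so that `D(1/r) = -K`) has norm `‖x‖⁻²`. [folklore] -/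
theorem norm_dipoleKernel {x : E3} (hx : x ≠ 0) :
    ‖(‖x‖ ^ 3)⁻¹ • (innerSL ℝ x : E3 →L[ℝ] ℝ)‖ = ‖x‖ ^ (-2 : ℝ) := by
  have hx' : 0 < ‖x‖ := norm_pos_iff.2 hx
  rw [norm_smul, norm_inv, norm_pow, norm_norm, innerSL_apply_norm, Real.rpow_neg hx'.le,
    show (2 : ℝ) = ((2 : ℕ) : ℝ) by norm_num, Real.rpow_natCast]
  field_simp

/-- `K = O(r⁻²)` along `cobounded`. [folklore] -/
theorem isBigO_dipoleKernel :
    (fun x : E3 ↦ (‖x‖ ^ 3)⁻¹ • (innerSL ℝ x : E3 →L[ℝ] ℝ)) =O[cobounded E3]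
      fun x ↦ ‖x‖ ^ (-2 : ℝ) := by
  refine IsBigO.of_bound 1 ?_
  filter_upwards [eventually_ne_cobounded (0 : E3)] with x hx
  rw [norm_dipoleKernel hx, one_mul, Real.norm_of_nonneg (Real.rpow_nonneg (norm_nonneg _) _)]

/-- **The gradient bound of `exists_hasHarmonicExpansion_fderiv` as an `O`-statement for
operator-valued functions**: `DU + b K = O(r⁻³)`, `K(x) = ‖x‖⁻³⟨x, ·⟩`. [folklore] -/
theorem isBigO_fderiv_add_dipole {U : E3 → ℝ} {b C T : ℝ}
    (h : ∀ x : E3, T ≤ ‖x‖ → ∀ w : E3, |fderiv ℝ U x w + b * ⟪x, w⟫ / ‖x‖ ^ 3| ≤ C * ‖w‖ / ‖x‖ ^ 3) :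
    (fun x ↦ fderiv ℝ U x + b • ((‖x‖ ^ 3)⁻¹ • (innerSL ℝ x : E3 →L[ℝ] ℝ))) =O[cobounded E3]
      fun x ↦ ‖x‖ ^ (-3 : ℝ) := by
  refine IsBigO.of_bound |C| ?_
  filter_upwards [eventually_cobounded_le_norm (E := E3) (max T 1)] with x hx
  have hxT : T ≤ ‖x‖ := (le_max_left T 1).trans hx
  have hx0 : 0 < ‖x‖ := lt_of_lt_of_le one_pos ((le_max_right T 1).trans hx)
  have hr : ‖‖x‖ ^ (-3 : ℝ)‖ = (‖x‖ ^ 3)⁻¹ := by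
    rw [Real.norm_of_nonneg (Real.rpow_nonneg (norm_nonneg _) _), Real.rpow_neg hx0.le,
      show (3 : ℝ) = ((3 : ℕ) : ℝ) by norm_num, Real.rpow_natCast]
  rw [hr]
  refine ContinuousLinearMap.opNorm_le_bound _ (by positivity) fun w ↦ ?_
  have h1 := h x hxT w
  have happ : (fderiv ℝ U x + b • ((‖x‖ ^ 3)⁻¹ • (innerSL ℝ x : E3 →L[ℝ] ℝ))) w =
      fderiv ℝ U x w + b * ⟪x, w⟫ / ‖x‖ ^ 3 := by
    simp only [_root_.add_apply, FunLike.coe_smul, Pi.smul_apply, innerSL_apply_apply,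
      smul_eq_mul]
    ring
  rw [happ, Real.norm_eq_abs]
  refine h1.trans ?_
  have h3 : 0 < ‖x‖ ^ 3 := pow_pos hx0 3
  rw [div_le_iff₀ h3]
  calc C * ‖w‖ ≤ |C| * ‖w‖ := mul_le_mul_of_nonneg_right (le_abs_self C) (norm_nonneg _)
    _ = |C| * (‖x‖ ^ 3)⁻¹ * ‖w‖ * ‖x‖ ^ 3 := by field_simp

/-- **Division of expansions at infinity, with gradient control.** If `𝒰 = a + b₁/r + O(r⁻²)`
with `a ≠ 0`, `V = aL + b₂/r + O(r⁻²)`, with `D𝒰 + b₁K, DV + b₂K = O(r⁻³)` (`K = ‖x‖⁻³⟨x,·⟩`)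
and `𝒰, V` differentiable far out, then `V/𝒰 = L − c/r + O(r⁻²)` and
`D(V/𝒰 − (L − c/r)) = O(r⁻³)` with `c = (L b₁ − b₂)/a`. [folklore] -/
theorem isBigO_div_sub_expansion {𝒰 V : E3 → ℝ} {a L b₁ b₂ : ℝ} (ha : a ≠ 0)
    (h𝒰 : HasHarmonicExpansion 𝒰 a b₁) (hV : HasHarmonicExpansion V (a * L) b₂)
    (h𝒰' : (fun x ↦ fderiv ℝ 𝒰 x + b₁ • ((‖x‖ ^ 3)⁻¹ • (innerSL ℝ x : E3 →L[ℝ] ℝ)))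
      =O[cobounded E3] fun x ↦ ‖x‖ ^ (-3 : ℝ))
    (hV' : (fun x ↦ fderiv ℝ V x + b₂ • ((‖x‖ ^ 3)⁻¹ • (innerSL ℝ x : E3 →L[ℝ] ℝ)))
      =O[cobounded E3] fun x ↦ ‖x‖ ^ (-3 : ℝ))
    (hd : ∀ᶠ x in cobounded E3, DifferentiableAt ℝ 𝒰 x ∧ DifferentiableAt ℝ V x) :
    (fun x ↦ V x / 𝒰 x - (L - (L * b₁ - b₂) / a / ‖x‖)) =O[cobounded E3]
        (fun x ↦ ‖x‖ ^ (-2 : ℝ)) ∧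
      (fun x ↦ ‖fderiv ℝ (fun y ↦ V y / 𝒰 y - (L - (L * b₁ - b₂) / a / ‖y‖)) x‖) =O[cobounded E3]
        fun x ↦ ‖x‖ ^ (-3 : ℝ) := by
  set c : ℝ := (L * b₁ - b₂) / a with hc_def
  set K : E3 → E3 →L[ℝ] ℝ := fun x ↦ (‖x‖ ^ 3)⁻¹ • (innerSL ℝ x : E3 →L[ℝ] ℝ) with hK_def
  -- basic asymptotics
  have h𝒰t : Tendsto 𝒰 (cobounded E3) (𝓝 a) := h𝒰.tendsto
  have hVt : Tendsto V (cobounded E3) (𝓝 (a * L)) := hV.tendsto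
  have h𝒰a := h𝒰.isBigO_sub_const
  have hVa := hV.isBigO_sub_const
  have h𝒰inv : (fun x ↦ (𝒰 x)⁻¹) =O[cobounded E3] (fun _ ↦ (1 : ℝ)) := (h𝒰t.inv₀ ha).isBigO_one ℝ
  have h𝒰b : 𝒰 =O[cobounded E3] (fun _ ↦ (1 : ℝ)) := h𝒰t.isBigO_one ℝ
  have hVb : V =O[cobounded E3] (fun _ ↦ (1 : ℝ)) := hVt.isBigO_one ℝ
  have h𝒰ne : ∀ᶠ x in cobounded E3, 𝒰 x ≠ 0 := h𝒰t.eventually_ne ha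
  have hx0 : ∀ᶠ x in cobounded E3, x ≠ (0 : E3) := eventually_ne_cobounded 0
  have hr1 : (fun x : E3 ↦ ‖x‖⁻¹) =O[cobounded E3] fun x ↦ ‖x‖ ^ (-1 : ℝ) :=
    (isBigO_refl _ _).congr_left fun x ↦ (inv_norm_eq_rpow x).symm
  have hac : a * c = L * b₁ - b₂ := by rw [hc_def]; field_simp
  refine ⟨?_, ?_⟩
  · -- the `C⁰` expansion
    have heq : (fun x ↦ V x / 𝒰 x - (L - c / ‖x‖)) =ᶠ[cobounded E3] fun x ↦
        ((V x - (a * L + b₂ * ‖x‖⁻¹)) - L * (𝒰 x - (a + b₁ * ‖x‖⁻¹))) * (𝒰 x)⁻¹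
          + c * ‖x‖⁻¹ * ((𝒰 x - a) * (𝒰 x)⁻¹) := by
      filter_upwards [h𝒰ne] with x hx
      have hb₂ : b₂ = L * b₁ - a * c := by linarith
      rw [hb₂]
      field_simp
      ring
    have t1 : (fun x ↦ ((V x - (a * L + b₂ * ‖x‖⁻¹)) - L * (𝒰 x - (a + b₁ * ‖x‖⁻¹))) * (𝒰 x)⁻¹)
        =O[cobounded E3] fun x ↦ ‖x‖ ^ (-2 : ℝ) :=
      ((hV.sub (h𝒰.const_mul_left L)).mul h𝒰inv).congr_right fun _ ↦ by simp
    have t2 : (fun x ↦ c * ‖x‖⁻¹ * ((𝒰 x - a) * (𝒰 x)⁻¹)) =O[cobounded E3]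
        fun x ↦ ‖x‖ ^ (-2 : ℝ) := by
      have h1 := (hr1.const_mul_left c).mul ((h𝒰a.mul h𝒰inv))
      refine h1.trans ?_
      refine (IsBigO.of_bound 1 ?_)
      filter_upwards [norm_rpow_mul_rpow_eventuallyEq (E := E3) (-1 : ℝ) (-1)] with x hx
      rw [mul_one, hx, show (-1 : ℝ) + -1 = -2 by norm_num, one_mul]
    exact (t1.add t2).congr' heq.symm EventuallyEq.rfl
  · -- the gradient: pointwise formula far out
    set T : E3 → E3 →L[ℝ] ℝ := fun x ↦
      (𝒰 x)⁻¹ • fderiv ℝ V x - (V x / 𝒰 x ^ 2) • fderiv ℝ 𝒰 x - c • K x with hT_def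
    have hderiv : ∀ᶠ x in cobounded E3,
        fderiv ℝ (fun y ↦ V y / 𝒰 y - (L - c / ‖y‖)) x = T x := by
      filter_upwards [h𝒰ne, hx0, hd] with x hne hx ⟨h𝒰d, hVd⟩
      have hinv : HasFDerivAt (fun y ↦ (𝒰 y)⁻¹) ((-(𝒰 x ^ 2)⁻¹) • fderiv ℝ 𝒰 x) x :=
        (hasDerivAt_inv hne).comp_hasFDerivAt x h𝒰d.hasFDerivAt
      have h1 : HasFDerivAt (fun y ↦ V y * (𝒰 y)⁻¹)
          (V x • ((-(𝒰 x ^ 2)⁻¹) • fderiv ℝ 𝒰 x) + (𝒰 x)⁻¹ • fderiv ℝ V x) x :=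
        hVd.hasFDerivAt.mul hinv
      have h2 : HasFDerivAt (fun y : E3 ↦ L - c * ‖y‖⁻¹)
          (-(c • (-(‖x‖ ^ 3)⁻¹ • (innerSL ℝ x : E3 →L[ℝ] ℝ)))) x :=
        ((hasFDerivAt_inv_norm hx).const_mul c).const_sub L
      have h3 := h1.sub h2
      have hfun : (fun y ↦ V y / 𝒰 y - (L - c / ‖y‖)) =
          (fun y ↦ V y * (𝒰 y)⁻¹) - fun y : E3 ↦ L - c * ‖y‖⁻¹ := by
        funext y
        simp only [Pi.sub_apply]
        rw [div_eq_mul_inv, div_eq_mul_inv]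
      rw [hfun, h3.fderiv, hT_def, hK_def]
      ext w
      simp only [_root_.sub_apply, _root_.add_apply, _root_.neg_apply, FunLike.coe_smul,
        Pi.smul_apply, smul_eq_mul]
      field_simp
      ring
    -- decomposition of `T`
    set β : E3 → ℝ := fun x ↦ -b₂ * ((𝒰 x)⁻¹ - a⁻¹) + b₁ * (V x / 𝒰 x ^ 2 - a * L / a ^ 2)
      with hβ_def
    have hTeq : ∀ᶠ x in cobounded E3, T x = (𝒰 x)⁻¹ • (fderiv ℝ V x + b₂ • K x)
        - (V x / 𝒰 x ^ 2) • (fderiv ℝ 𝒰 x + b₁ • K x) + β x • K x := by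
      filter_upwards [h𝒰ne] with x hne
      have hLa : a * L / a ^ 2 = L / a := by field_simp
      rw [hT_def, hβ_def, hLa]
      ext w
      simp only [_root_.sub_apply, _root_.add_apply, FunLike.coe_smul, Pi.smul_apply,
        smul_eq_mul, hc_def]
      field_simp
      ring
    have hβ : β =O[cobounded E3] fun x ↦ ‖x‖ ^ (-1 : ℝ) := by
      have hA : (fun x ↦ -b₂ * ((𝒰 x)⁻¹ - a⁻¹)) =O[cobounded E3] fun x ↦ ‖x‖ ^ (-1 : ℝ) :=
        (isBigO_inv_sub_inv ha h𝒰t h𝒰a).const_mul_left (-b₂)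
      have hB : (fun x ↦ b₁ * (V x / 𝒰 x ^ 2 - a * L / a ^ 2)) =O[cobounded E3]
          fun x ↦ ‖x‖ ^ (-1 : ℝ) :=
        (isBigO_div_sq_sub ha h𝒰t h𝒰a hVa).const_mul_left b₁
      exact hA.add hB
    have hK : K =O[cobounded E3] fun x ↦ ‖x‖ ^ (-2 : ℝ) := isBigO_dipoleKernel
    have hV𝒰 : (fun x ↦ V x / 𝒰 x ^ 2) =O[cobounded E3] (fun _ ↦ (1 : ℝ)) := by
      have := hVb.mul (h𝒰inv.mul h𝒰inv)
      refine (this.congr_left fun x ↦ ?_).congr_right fun _ ↦ by simp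
      rw [div_eq_mul_inv, ← inv_pow, sq]
    have t1 : (fun x ↦ (𝒰 x)⁻¹ • (fderiv ℝ V x + b₂ • K x)) =O[cobounded E3]
        fun x ↦ ‖x‖ ^ (-3 : ℝ) :=
      (h𝒰inv.smul hV').congr_right fun _ ↦ by simp
    have t2 : (fun x ↦ (V x / 𝒰 x ^ 2) • (fderiv ℝ 𝒰 x + b₁ • K x)) =O[cobounded E3]
        fun x ↦ ‖x‖ ^ (-3 : ℝ) :=
      (hV𝒰.smul h𝒰').congr_right fun _ ↦ by simp
    have t3 : (fun x ↦ β x • K x) =O[cobounded E3] fun x ↦ ‖x‖ ^ (-3 : ℝ) := by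
      refine (hβ.smul hK).trans (IsBigO.of_bound 1 ?_)
      filter_upwards [norm_rpow_mul_rpow_eventuallyEq (E := E3) (-1 : ℝ) (-2)] with x hx
      rw [smul_eq_mul, hx, show (-1 : ℝ) + -2 = -3 by norm_num, one_mul]
    have hTO : T =O[cobounded E3] fun x ↦ ‖x‖ ^ (-3 : ℝ) :=
      ((t1.sub t2).add t3).congr' (hTeq.mono fun x hx ↦ hx.symm) EventuallyEq.rfl
    refine (hTO.norm_left.congr' ?_ EventuallyEq.rfl)
    filter_upwards [hderiv] with x hx
    rw [hx]

end Division

/-! ## Harmonic functions on an end, read in the chart -/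

namespace AFEnd

variable {X : Type} [TopologicalSpace X] [ChartedSpace E3 X] [IsManifold (𝓡 3) ∞ X]
  (e : AFEnd X) (D : InitialDataSet (𝓡 3) X) [D.metric.HasLeviCivita]

omit [IsManifold (𝓡 3) ∞ X] in
/-- A function of class `C^n` at a point of the end, read in the chart, is `C^n` at the
corresponding point of the shell `{R < ‖z‖}` (local form of `AFEnd.contDiffAt_endValue`).
[folklore] -/
theorem contDiffAt_endValue_of_contMDiffAt {φ : X → ℝ} {n : ℕ∞} {z : E3} (hz : e.R < ‖z‖)
    (hφ : ContMDiffAt (𝓡 3) 𝓘(ℝ, ℝ) n φ (e.dataChart ⟨z, hz⟩)) :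
    ContDiffAt ℝ n (endValue e φ) z := by
  have h1 : ContMDiffAt (𝓡 3) 𝓘(ℝ, ℝ) n φ (e.dataChartExt z) := by
    rw [e.dataChartExt_of_lt hz]
    exact hφ
  have h2 : ContMDiffAt 𝓘(ℝ, E3) 𝓘(ℝ, ℝ) n (φ ∘ e.dataChartExt) z :=
    h1.comp z ((e.contMDiffAt_dataChartExt hz).of_le (WithTop.coe_le_coe.mpr le_top))
  have h3 : endValue e φ =ᶠ[𝓝 z] φ ∘ e.dataChartExt := by
    filter_upwards [(isOpen_lt continuous_const continuous_norm).mem_nhds hz] with w hw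
    rw [endValue_of_lt e φ hw, Function.comp_apply, e.dataChartExt_of_lt hw]
  exact contMDiffAt_iff_contDiffAt.1 (h2.congr_of_eventuallyEq h3)

/-- **The Laplace–Beltrami operator read in the chart of the end**: for `φ` of class `C²` at
`Φ z`, `Δ_h φ (Φ z) = Δ_G (φ ∘ Φ)(z)` where `G = hCoeff e D` are the chart components,
`Δ_G = MetricCoord.lapAt G` the coordinate Laplace–Beltrami operator, and `φ ∘ Φ = endValue e φ`
on the shell (naturality of `□` under the inverse chart, `dalembertian_comap`, and the chart
formula `OpensChart.dalembertian_eq_lapAt`). O'Neill 1983, Ch. 3, Def. 3.50 ff.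
[cite: ONeill1983, Ch. 3, Def. 3.50 ff.] -/
theorem dalembertian_dataChart_eq_lapAt_endValue {φ : X → ℝ} (z : exteriorRegion e.R)
    (hφ : ContMDiffAt (𝓡 3) 𝓘(ℝ, ℝ) 2 φ (e.dataChart z)) :
    D.metric.dalembertian φ (e.dataChart z) = MetricCoord.lapAt (hCoeff e D) (endValue e φ) z := by
  set γ := D.metric.comap PseudoRiemannianMetric.contMDiff_pullbackBilin_holds e.dataChart
    e.contMDiff_dataChart_succ e.injective_mfderiv_dataChart rfl with hγ
  haveI : γ.HasLeviCivita := γ.hasLeviCivita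
  have hnat := D.metric.dalembertian_comap PseudoRiemannianMetric.contMDiff_pullbackBilin_holds
    e.contMDiff_dataChart_succ e.injective_mfderiv_dataChart rfl hφ
  rw [← hnat]
  have hrepr : ∀ y : exteriorRegion e.R, (φ ∘ e.dataChart) y = endValue e φ y := fun y ↦ by
    rw [Function.comp_apply, endValue_of_lt e φ y.2]
  have hz : e.R < ‖(z : E3)‖ := z.2
  have hφ' : ContMDiffAt (𝓡 3) 𝓘(ℝ, ℝ) ((2 : ℕ∞) : ℕ∞ω) φ (e.dataChart ⟨z, hz⟩) := hφ
  exact OpensChart.dalembertian_eq_lapAt (e.val_comap_dataChart D) z hrepr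
    (e.contDiffAt_endValue_of_contMDiffAt hz hφ')

namespace IsHarmonicallyFlatWith

variable {e D} {R₁ : ℝ} {𝒰 : E3 → ℝ}

/-- **The conformal factor of a harmonically flat end is smooth** beyond `R₁`: there
`𝒰⁴ = h₁₁` is a chart component of the smooth metric, and `𝒰 > 0`. [cite: BrayRPI2001, §2 Def. 1] -/
theorem contDiffAt_factor (hHF : e.IsHarmonicallyFlatWith D R₁ 𝒰) {z : E3} (hz : R₁ < ‖z‖) :
    ContDiffAt ℝ ∞ 𝒰 z := by
  have hzR : e.R < ‖z‖ := lt_of_le_of_lt hHF.le_radius hz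
  set e₀ : E3 := EuclideanSpace.single (0 : Fin 3) (1 : ℝ) with he₀
  -- `𝒰⁴ = hCoeff(e₀, e₀)` near `z`
  have h4 : (fun y ↦ 𝒰 y ^ 4) =ᶠ[𝓝 z] fun y ↦ hCoeff e D y e₀ e₀ := by
    filter_upwards [(isOpen_lt continuous_const continuous_norm).mem_nhds hz] with y hy
    rw [hHF.hCoeff_eq hy]
    simp only [FunLike.coe_smul, Pi.smul_apply, smul_eq_mul, he₀]
    rw [show (innerSL ℝ (E := E3) : E3 →L[ℝ] E3 →L[ℝ] ℝ) (EuclideanSpace.single 0 1)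
        (EuclideanSpace.single 0 1) = ⟪EuclideanSpace.single (0 : Fin 3) (1 : ℝ),
          EuclideanSpace.single (0 : Fin 3) (1 : ℝ)⟫ from rfl]
    simp
  have hs4 : ContDiffAt ℝ ∞ (fun y ↦ 𝒰 y ^ 4) z := by
    refine ContDiffAt.congr_of_eventuallyEq ?_ h4
    exact ((e.contDiffAt_hCoeff D hzR).clm_apply contDiffAt_const).clm_apply contDiffAt_const
  -- `𝒰 = (𝒰⁴)^{1/4}` near `z`
  have heq : 𝒰 =ᶠ[𝓝 z] fun y ↦ (𝒰 y ^ 4) ^ ((4 : ℕ) : ℝ)⁻¹ := by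
    filter_upwards [(isOpen_lt continuous_const continuous_norm).mem_nhds hz] with y hy
    rw [Real.pow_rpow_inv_natCast (hHF.pos hy).le four_ne_zero]
  refine ContDiffAt.congr_of_eventuallyEq ?_ heq
  exact hs4.rpow_const_of_ne (pow_ne_zero 4 (hHF.pos hz).ne')

/-- The conformal factor is smooth on the open shell `{R₁ < ‖z‖}`. [cite: BrayRPI2001, §2 Def. 1] -/
theorem contDiffOn_factor (hHF : e.IsHarmonicallyFlatWith D R₁ 𝒰) :
    ContDiffOn ℝ ∞ 𝒰 {z : E3 | R₁ < ‖z‖} := fun _ hz ↦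
  (hHF.contDiffAt_factor hz).contDiffWithinAt

/-- **`h`-harmonic functions on a harmonically flat end are `δ`-harmonic after multiplication
by the conformal factor.** Let the end `e` be harmonically flat beyond `R₁` with factor `𝒰`
(`h_{ij} = 𝒰⁴ δ_{ij}`, `𝒰` harmonic), and let `φ` be of class `C²` with `Δ_h φ = 0` at the
points `Φ y`, `‖y‖ > R₂`. Then `𝒰 · (φ ∘ Φ)` is harmonic (Mathlib's `InnerProductSpace.HarmonicAt`,
flat Laplacian) at every `z` with `‖z‖ > max R₁ R₂`: by the conformal covariance
`Δ_δ(𝒰F) = 𝒰⁵ Δ_{𝒰⁴δ} F + F Δ_δ 𝒰` (`MetricCoord.laplacian_mul_eq_of_conformal`) with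
`Δ_{𝒰⁴δ} F = Δ_h φ ∘ Φ = 0` (`dalembertian_dataChart_eq_lapAt_endValue`) and `Δ_δ 𝒰 = 0`. This is
the reduction behind Bray's expansions (10) and (87) ("expand in spherical harmonics").
[cite: BrayRPI2001, §2 (9)–(10) and §6 (87)] -/
theorem harmonicAt_factor_mul_endValue (hHF : e.IsHarmonicallyFlatWith D R₁ 𝒰) {φ : X → ℝ}
    {R₂ : ℝ} (hφ : ∀ y : exteriorRegion e.R, R₂ < ‖(y : E3)‖ →
      ContMDiffAt (𝓡 3) 𝓘(ℝ, ℝ) 2 φ (e.dataChart y))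
    (hΔ : ∀ y : exteriorRegion e.R, R₂ < ‖(y : E3)‖ → D.metric.dalembertian φ (e.dataChart y) = 0)
    {z : E3} (hz : max R₁ R₂ < ‖z‖) :
    HarmonicAt (fun y ↦ 𝒰 y * endValue e φ y) z := by
  set V : Set E3 := {y | max R₁ R₂ < ‖y‖} with hV_def
  have hVo : IsOpen V := isOpen_lt continuous_const continuous_norm
  have hV1 : ∀ y ∈ V, R₁ < ‖y‖ := fun y hy ↦ lt_of_le_of_lt (le_max_left _ _) hy
  have hV2 : ∀ y ∈ V, R₂ < ‖y‖ := fun y hy ↦ lt_of_le_of_lt (le_max_right _ _) hy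
  have hVR : ∀ y ∈ V, e.R < ‖y‖ := fun y hy ↦ lt_of_le_of_lt hHF.le_radius (hV1 y hy)
  have hw : ContDiffOn ℝ ∞ 𝒰 V := hHF.contDiffOn_factor.mono fun y hy ↦ hV1 y hy
  have hw0 : ∀ y ∈ V, 𝒰 y ≠ 0 := fun y hy ↦ (hHF.pos (hV1 y hy)).ne'
  have hF2 : ∀ y ∈ V, ContDiffAt ℝ 2 (endValue e φ) y := fun y hy ↦
    e.contDiffAt_endValue_of_contMDiffAt (n := 2) (hVR y hy) (hφ ⟨y, hVR y hy⟩ (hV2 y hy))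
  -- the identity `Δ(𝒰F) = 0` on `V`
  have key : ∀ y ∈ V, (Δ fun w ↦ 𝒰 w * endValue e φ w) y = 0 := by
    intro y hy
    set b := stdOrthonormalBasis ℝ E3
    have hcard : Fintype.card (Fin (Module.finrank ℝ E3)) = 3 := by
      rw [Fintype.card_fin, finrank_euclideanSpace_fin]
    rw [MetricCoord.laplacian_mul_eq_of_conformal b hcard hVo hw hw0 hy (hF2 y hy)]
    -- `Δ_{𝒰⁴δ} F (y) = Δ_h φ (Φ y) = 0`
    have hlap : MetricCoord.lapAt (fun w ↦ 𝒰 w ^ 4 • (innerSL ℝ (E := E3) : E3 →L[ℝ] E3 →L[ℝ] ℝ))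
        (endValue e φ) y = 0 := by
      have hcongr : hCoeff e D =ᶠ[𝓝 y]
          fun w ↦ 𝒰 w ^ 4 • (innerSL ℝ (E := E3) : E3 →L[ℝ] E3 →L[ℝ] ℝ) := by
        filter_upwards [(isOpen_lt continuous_const continuous_norm).mem_nhds (hV1 y hy)]
          with w hw'
        exact hHF.hCoeff_eq hw'
      rw [← MetricCoord.lapAt_congr_metric hcongr,
        ← e.dalembertian_dataChart_eq_lapAt_endValue D ⟨y, hVR y hy⟩ (hφ ⟨y, hVR y hy⟩ (hV2 y hy))]
      exact hΔ ⟨y, hVR y hy⟩ (hV2 y hy)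
    -- `Δ 𝒰 (y) = 0`
    have hU : (Δ 𝒰) y = 0 := (hHF.harmonicOnNhd y (hV1 y hy)).2.eq_of_nhds
    rw [hlap, hU, mul_zero, mul_zero, add_zero]
  have hzV : z ∈ V := hz
  refine ⟨?_, ?_⟩
  · exact (((hw z hzV).contDiffAt (hVo.mem_nhds hzV)).of_le (WithTop.coe_le_coe.mpr le_top)).mul
      (hF2 z hzV)
  · filter_upwards [hVo.mem_nhds hzV] with y hy
    exact key y hy

/-- **Bray's expansion (87) on a harmonically flat end.** Let the end `e` be harmonically flat
beyond `R₁` with conformal factor `𝒰` (Bray 2001, §2 Def. 1: `h_{ij} = 𝒰⁴ δ_{ij}`, `𝒰` harmonic,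
`𝒰 → a > 0`), and let `φ` be of class `C²` with `Δ_h φ = 0` at the points `Φ y`, `‖y‖ > R₂`, and
`φ → L` at infinity in the end. Then, in the chart of the end,
**`φ ∘ Φ = L − c/r + O(r⁻²)` and `D(φ ∘ Φ − (L − c/r)) = O(r⁻³)`** for some constant `c` — Bray,
§6, (87): *"`φ(x) = 1 − ℰ/(2|x|) + O(1/|x|²)`"* for the Green's function (86) (and §2 (10) for
`𝒰` itself), there "by expanding in spherical harmonics"; here: `𝒰 · (φ ∘ Φ)` is flat-harmonic
(`harmonicAt_factor_mul_endValue`) and tends to `aL`, so it and `𝒰` have expansions with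
gradient control by Green's representation formula (`exists_hasHarmonicExpansion_fderiv`,
`HarmonicallyFlatGradientProofs.lean`), and the quotient is expanded by
`isBigO_div_sub_expansion` (`c = (L b₁ − b₂)/a` in terms of the monopole coefficients `b₁` of
`𝒰` and `b₂` of `𝒰 · (φ ∘ Φ)`). The second conclusion is exactly the hypothesis `hexp` of the
capacity theorems of `MassCapacityExpansion.lean`. [cite: BrayRPI2001, §6 (87) and §2 (10)] -/
theorem exists_expansion_fderiv_of_dalembertian_eq_zero (hHF : e.IsHarmonicallyFlatWith D R₁ 𝒰)
    {φ : X → ℝ} {R₂ : ℝ}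
    (hφ : ∀ y : exteriorRegion e.R, R₂ < ‖(y : E3)‖ →
      ContMDiffAt (𝓡 3) 𝓘(ℝ, ℝ) 2 φ (e.dataChart y))
    (hΔ : ∀ y : exteriorRegion e.R, R₂ < ‖(y : E3)‖ → D.metric.dalembertian φ (e.dataChart y) = 0)
    {L : ℝ} (hL : TendstoAtEnd e φ L) :
    ∃ c : ℝ, (fun x ↦ endValue e φ x - (L - c / ‖x‖)) =O[cobounded E3]
        (fun x ↦ ‖x‖ ^ (-2 : ℝ)) ∧
      (fun x ↦ ‖fderiv ℝ (fun y ↦ endValue e φ y - (L - c / ‖y‖)) x‖) =O[cobounded E3]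
        fun x ↦ ‖x‖ ^ (-3 : ℝ) := by
  obtain ⟨a, ha, h𝒰a⟩ := hHF.exists_tendsto
  -- `V = 𝒰 (φ ∘ Φ)` is flat-harmonic beyond `max R₁ R₂` and tends to `a L`
  have hVh : HarmonicOnNhd (fun y ↦ 𝒰 y * endValue e φ y) {x : E3 | max R₁ R₂ < ‖x‖} :=
    fun z hz ↦ hHF.harmonicAt_factor_mul_endValue hφ hΔ hz
  have hVt : Tendsto (fun y ↦ 𝒰 y * endValue e φ y) (cobounded E3) (𝓝 (a * L)) := h𝒰a.mul hL
  obtain ⟨b₂, C₂, T₂, hV, -, hV'⟩ := exists_hasHarmonicExpansion_fderiv (max R₁ R₂) _ (a * L) hVh hVt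
  obtain ⟨b₁, C₁, T₁, h𝒰, -, h𝒰'⟩ :=
    exists_hasHarmonicExpansion_fderiv R₁ 𝒰 a hHF.harmonicOnNhd h𝒰a
  have hd : ∀ᶠ x in cobounded E3, DifferentiableAt ℝ 𝒰 x ∧
      DifferentiableAt ℝ (fun y ↦ 𝒰 y * endValue e φ y) x := by
    filter_upwards [eventually_cobounded_le_norm (E := E3) (max R₁ R₂ + 1)] with x hx
    have h1 : R₁ < ‖x‖ := by linarith [le_max_left R₁ R₂]
    have h2 : max R₁ R₂ < ‖x‖ := by linarith
    exact ⟨(hHF.harmonicOnNhd x h1).1.differentiableAt (by simp),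
      (hVh x h2).1.differentiableAt (by simp)⟩
  obtain ⟨h0, h1⟩ := isBigO_div_sub_expansion ha.ne' h𝒰 hV (isBigO_fderiv_add_dipole h𝒰')
    (isBigO_fderiv_add_dipole hV') hd
  -- `V/𝒰 = φ ∘ Φ` beyond `R₁`
  have heq : ∀ x : E3, R₁ < ‖x‖ → 𝒰 x * endValue e φ x / 𝒰 x = endValue e φ x := fun x hx ↦ by
    field_simp [(hHF.pos hx).ne']
  refine ⟨(L * b₁ - b₂) / a, ?_, ?_⟩
  · refine h0.congr' ?_ EventuallyEq.rfl
    filter_upwards [eventually_cobounded_le_norm (E := E3) (R₁ + 1)] with x hx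
    rw [heq x (by linarith)]
  · refine h1.congr' ?_ EventuallyEq.rfl
    filter_upwards [eventually_cobounded_le_norm (E := E3) (R₁ + 1)] with x hx
    have hfe : (fun y ↦ 𝒰 y * endValue e φ y / 𝒰 y - (L - (L * b₁ - b₂) / a / ‖y‖)) =ᶠ[𝓝 x]
        fun y ↦ endValue e φ y - (L - (L * b₁ - b₂) / a / ‖y‖) := by
      filter_upwards [(isOpen_lt continuous_const continuous_norm).mem_nhds
        (show R₁ < ‖x‖ by linarith)] with y hy
      rw [heq y hy]
    rw [hfe.fderiv_eq]

end IsHarmonicallyFlatWith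

end AFEnd

end Literature.Geometry.Lorentzian

end
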